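import Summits.BirchSwinnertonDyer.BirchSwinnertonDyer.Theses.UniversalToricDescent
import Summits.BirchSwinnertonDyer.BirchSwinnertonDyer.Theorems.UniversalToricDescentRelaxedDualChain
import Summits.BirchSwinnertonDyer.BirchSwinnertonDyer.Theorems.UniversalToricDescentRelaxedSignatureKernel
import Summits.BirchSwinnertonDyer.BirchSwinnertonDyer.Theorems.UniversalToricDescentLayerKummerProduct
import Summits.BirchSwinnertonDyer.BirchSwinnertonDyer.Theorems.UniversalToricDescentDefectTransportModThreePTStubLocalTorsionCountAtTame
import Literature.NumberTheory.EllipticCurves.HeegnerPointsImaginaryQuadraticProofs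
import HarnessLib

/-!
# STUB R1 `stub_relaxedImageCount` of the crux ♭T≤ `DefectTransportModThreePT` (stmt-BirchSwinnertonDyer-23042), line `sigmacongruence`
# (skeleton v9): the RELAXED COUNT ROAD, assembled

Route `UniversalToricDescent`, lead prover `bsd-wall-utd-p1` g18 (design, bricks (a)–(f), this assembly; `--supports stmt-BirchSwinnertonDyer-23042`,
registered stub, proved VERBATIM); compile fixes and landing by width seat `bsd-wall-utd-p1-w2` g4 (assembly arithmetic without `set`
abbreviations, torsion transport through `congrArg`/`map_nsmul`).
THEOREMS ONLY (no definition, no named fact, no `sorry`). BSD is not proved by any of this.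

For every `k ≥ 1`, at a deep layer `K_m` of the anticyclotomic tower (`m ≥ m₀(k)`), with `T` the places over `{3-places} ∪ S`, `V` the `3^c`
places over `v`, and the Kummer structures of `E_{K_m}[3^k]` (`KO` relaxed / `KS` strict on the named places and at infinity):
* (a)+(e)+R3 [width `utd-p1-w2`, `…LayerKummerProduct.exists_forall_natCard_tuples_le_pairCount`]:
  `#tuples[3^k] ≤ #(KO(T∪V)/KO(T)) · #(KS(T)/KS(T∪V))` (Poitou–Tate for the pair `KO(T) ≤ KO(T∪V)`, local sizes, place count);
* (d) [`…RelaxedDualChain.exists_level_dualIndex_le`]: `#(KS(T)/KS(T∪V)) ≤ t₆^{3^c}`, `t₆ = #(E(K_{∞,η})[3^∞]/Div)`;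
* (c) [`…RelaxedSignatureKernel.relIndex_kummerRelaxed_le` + width's `…LayerDescentKernelIndex`]: `#(KO(T∪V)/KO(T)) ≤ #Σ(KO(T∪V)) · t₄^{3^c}`;
* (f) [`…RelaxedKummerImage`]: every signature `Σ y`, `y ∈ KO(T∪V)`, is the `v`-signature of `s = h_m(Φ y) ∈ Sel^{S∪v}_{v₀}(K_∞, E[3^∞])[3^k]`.
Hence `#tuples[3^k] ≤ (t₄+1)^{3^c} t₆^{3^c} · #{signatures of Sel^{S∪v}_{v₀}[3^k]}`; `k = 0` is trivial.

References: [GreenbergVatsal2000] §2 (Prop. (2.1), Cor. (2.3), pp. 24–25); [GreenbergLNM1716] §2 Prop. 2.1, §3 Lemma 3.1 and 3.3;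
[MilneADT2006] I Lemma 3.3, Thm. 4.10, §6; [Castella2018] Def. 2.2; [Washington1997] §13.1.
-/

set_option linter.dupNamespace false
set_option autoImplicit false

noncomputable section
open scoped Classical
open scoped NumberField.LiesOver

namespace Summit.BirchSwinnertonDyer.BirchSwinnertonDyer.Cruxes.DefectTransportModThreePT.SigmaCongruence

open WeierstrassCurve NumberField IsDedekindDomain Field
  Literature.NumberTheory.EllipticCurves
  Literature.NumberTheory.EllipticCurves.Rank1Residual
  Literature.NumberTheory.EllipticCurves.GreenbergSelmer
  Literature.NumberTheory.GaloisRepresentations Literature.NumberTheory.GaloisCohomology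
  Literature.NumberTheory.GaloisRepresentations.DiscreteGaloisModule
  Summit.BirchSwinnertonDyer.Rank1Residual Summit.BirchSwinnertonDyer.Rank1Residual.X11b
  Summit.BirchSwinnertonDyer.Rank1Residual.X11b.AcSelmer Summit.BirchSwinnertonDyer.Rank1Residual.X11b.Coinv
  Summit.BirchSwinnertonDyer.Rank1Residual.X11b.KummerPT
  Summit.BirchSwinnertonDyer.BirchSwinnertonDyer.Theorems
  Summit.BirchSwinnertonDyer.BirchSwinnertonDyer.Theorems.SignedEC.RelaxedKummerCount
  Summit.BirchSwinnertonDyer.BirchSwinnertonDyer.Theorems.UniversalToricDescentTowerDescent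
  Summit.BirchSwinnertonDyer.BirchSwinnertonDyer.Theorems.UniversalToricDescentSigmaLocalImage
  Summit.BirchSwinnertonDyer.BirchSwinnertonDyer.Theorems.UniversalToricDescentRelaxedLayerSelmer
  Summit.BirchSwinnertonDyer.BirchSwinnertonDyer.Theorems.UniversalToricDescentRelaxedLocalLevelShift
  Summit.BirchSwinnertonDyer.BirchSwinnertonDyer.Theorems.UniversalToricDescentRelaxedLayerTransportTorsion
  Summit.BirchSwinnertonDyer.BirchSwinnertonDyer.Theorems.UniversalToricDescentRelaxedKummerImage
  Summit.BirchSwinnertonDyer.BirchSwinnertonDyer.Theorems.UniversalToricDescentRelaxedDualChain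
  Summit.BirchSwinnertonDyer.BirchSwinnertonDyer.Theorems.UniversalToricDescentRelaxedSignatureKernel
  Summit.BirchSwinnertonDyer.BirchSwinnertonDyer.Theorems.UniversalToricDescentLayerKummerProduct
  Summit.BirchSwinnertonDyer.BirchSwinnertonDyer.Theorems.UniversalToricDescentLayerFixedFinite
  Summit.BirchSwinnertonDyer.BirchSwinnertonDyer.Theorems.UniversalToricDescentCofiniteDivisiblePart

set_option maxHeartbeats 400000 in
/-- **STUB R1 `stub_relaxedImageCount` (skeleton v9 of the line `sigmacongruence`), PROVED** — the relaxed count road (module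
docstring): for `t = (t₄+1)^{3^c} · t₆^{3^c}` (the uniform layer-kernel bound of the local anticyclotomic tower at `v` and the index of the
divisible part of `E(K_{∞,η})[3^∞]`), every `k`, the `3^k`-torsion signature tuples are at most `t` times the signatures realised by
`Sel^{S∪v}_{v₀}(K_∞, E[3^∞])[3^k]`. [cite: GreenbergVatsal2000, §2 Prop. (2.1), Cor. (2.3) (pp. 24–25)] [cite: GreenbergLNM1716, §3 Lemma 3.1 (pp. 85–87)]
[cite: MilneADT2006, Ch. I, Thm. 4.10 and Lemma 3.3] -/
theorem stub_relaxedImageCount :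
    Summit.BirchSwinnertonDyer.BirchSwinnertonDyer.Theses.UniversalToricDescent.PoitouTateSelmerStructureDualityFact →
    ∀ (W' : WeierstrassCurve ℚ) [W'.IsElliptic] [W'.IsGloballyMinimal] (K : Type) [Field K] [NumberField K],
      ¬ Addv W' 3 → IsImaginaryQuadratic K → SplitsIn K 3 →
      ∀ (κ : ZpExtension K 3), κ.IsAnticyclotomic → ∀ (γ : absoluteGaloisGroup K) [Fact (κ.IsTopGenerator γ)]
      (𝔭 𝔭' : HeightOneSpectrum (𝓞 K)), ((3 : ℕ) : 𝓞 K) ∈ 𝔭.asIdeal → ((3 : ℕ) : 𝓞 K) ∈ 𝔭'.asIdeal → 𝔭 ≠ 𝔭' →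
      (∀ m : (W'.baseChange K).geomPrimaryTorsion 3, (∀ σ ∈ κ.kerSubgroup, σ • m = m) → 3 • m = 0 → m = 0) →
      ∀ (S : Set (HeightOneSpectrum (𝓞 K))), S.Finite →
      (∀ v ∈ S, ((3 : ℕ) : 𝓞 K) ∉ v.asIdeal ∧ ¬ (decomp v ≤ κ.kerSubgroup)) →
      ∀ (v : HeightOneSpectrum (𝓞 K)), ((3 : ℕ) : 𝓞 K) ∉ v.asIdeal → v ∉ S → ¬ (decomp v ≤ κ.kerSubgroup) →
      Set.Finite {s : selmerAc (W'.baseChange K) 3 κ 𝔭' (insert v S) | 3 • s = 0} →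
      ∀ (v₀ : HeightOneSpectrum (𝓞 K)), ((3 : ℕ) : 𝓞 K) ∉ v₀.asIdeal → v₀ ∉ insert v S →
      ∀ (c : ℕ) (d₁ : decomp (K := K) v), (κ (d₁ : absoluteGaloisGroup K)).toAdd = (3 : ℤ_[3]) ^ c →
      (∀ z : ℤ_[3], ∃ d : decomp (K := K) v, (κ (d : absoluteGaloisGroup K)).toAdd = (3 : ℤ_[3]) ^ c * z) →
      (∀ d : decomp (K := K) v, (3 : ℤ_[3]) ^ c ∣ (κ (d : absoluteGaloisGroup K)).toAdd) →
      (∀ k : ℕ, Nat.card {f : subgroupH1 (kerD κ v) ((W'.baseChange K).geomPrimaryTorsion 3) // 3 ^ k • f = 0} ≤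
        Nat.card {a : (W'.baseChange K).geomPrimaryTorsion 3 //
          (∀ g : kerD κ v, ((g : decomp (K := K) v) : absoluteGaloisGroup K) • a = a) ∧ 3 ^ k • a = 0}) →
      ∃ t : ℕ, 0 < t ∧ ∀ k : ℕ,
        Nat.card {θ : Fin (3 ^ c) → subgroupH1 (kerD κ v) ((W'.baseChange K).geomPrimaryTorsion 3) // 3 ^ k • θ = 0} ≤
          t * Nat.card {θ : Fin (3 ^ c) → subgroupH1 (kerD κ v) ((W'.baseChange K).geomPrimaryTorsion 3) //
            3 ^ k • θ = 0 ∧ ∃ s : (W'.baseChange K).subgroupH1 3 κ.kerSubgroup,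
              s ∈ selmerAc (W'.baseChange K) 3 κ v₀ (insert v S) ∧ 3 ^ k • s = 0 ∧
              ∀ i : Fin (3 ^ c), θ i = resKerD κ ((W'.baseChange K).geomPrimaryTorsion 3) v
                ((W'.baseChange K).conjH1 3 κ.kerSubgroup (γ ^ (i : ℕ)) s)} := by
  intro hPTfact W' _ _ K _ _ _ hK _ κ _ γ _ 𝔭 𝔭' _ h𝔭' _ hB0 S hS _ v hv hvS hvd hfin v₀ hv₀ hv₀S c d₁ hd₁ hc hdvd hR3
  classical
  -- notation and standing facts
  set W : WeierstrassCurve K := W'.baseChange K with hW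
  haveI hKc : IsTotallyComplex K := hK.isTotallyComplex
  have hKx : ∀ w₀ : InfinitePlace K, w₀.IsComplex := fun w₀ ↦ IsTotallyComplex.isComplex w₀
  have hγ : κ.IsTopGenerator γ := Fact.out
  have hB : FixedPoints.addSubgroup κ.kerSubgroup (W.geomPrimaryTorsion 3) = ⊥ := fixedPoints_kerSubgroup_eq_bot_of W 3 κ hB0
  have h3 : (3 : ℕ).Prime := Nat.prime_three
  -- the finite set `T_K = {3-places} ∪ S` and the place finsets of the layers
  have hTKfin : ({u : HeightOneSpectrum (𝓞 K) | ((3 : ℕ) : 𝓞 K) ∈ u.asIdeal} ∪ S).Finite := by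
    refine Set.Finite.union ?_ hS
    have h := finite_setOf_intCast_mem_asIdeal (K := K) (n := 3) (by norm_num)
    refine h.subset fun u hu ↦ ?_
    simp only [Set.mem_setOf_eq] at hu ⊢
    exact_mod_cast hu
  set TK : Finset (HeightOneSpectrum (𝓞 K)) := hTKfin.toFinset with hTKdef
  have hTK : ∀ u, u ∈ TK ↔ ((3 : ℕ) : 𝓞 K) ∈ u.asIdeal ∨ u ∈ S := fun u ↦ by
    rw [hTKdef, Set.Finite.mem_toFinset, Set.mem_union, Set.mem_setOf_eq]
  have h𝔭'T : 𝔭' ∈ TK := (hTK 𝔭').mpr (Or.inl h𝔭')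
  have hvT : v ∉ TK := fun h ↦ ((hTK v).mp h).elim hv hvS
  have hTKset : ∀ u, u ∈ (TK : Set (HeightOneSpectrum (𝓞 K))) ↔ u ∈ TK := fun u ↦ Finset.mem_coe
  have hTL0 := fun n : ℕ ↦ exists_finset_forall_mem_iff_under_mem (L := κ.layer n) (TK.finite_toSet)
  choose TL hTL' using hTL0
  have hTL : ∀ (n : ℕ) (w : HeightOneSpectrum (𝓞 (κ.layer n))), w ∈ TL n ↔ w.under (𝓞 K) ∈ TK :=
    fun n w ↦ (hTL' n w).trans (hTKset _)
  have hVL0 := fun n : ℕ ↦ exists_finset_forall_mem_iff_under_eq (L := κ.layer n) v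
  choose VL hVL using hVL0
  -- `t₆`: the divisible part of `E(K_{∞,η})[3^∞]`
  obtain ⟨D, -, hDmem, hDdiv, -, hDfin⟩ := exists_divisiblePart (p := 3)
    (exists_pow_smul_fixedPoints_kerD_eq_zero κ W v) (finite_setOf_fixedPoints_kerD_smul_eq_zero κ W v)
  haveI := hDfin
  have ht₆pos : 0 < Nat.card (FixedPoints.addSubgroup (kerD κ v) (W.geomPrimaryTorsion 3) ⧸ D) := Nat.card_pos
  -- `t₄`: the uniform layer-kernel bound of the local tower at `v` (width `utd-p1-w2`, `…LayerDescentKernelIndex`)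
  haveI : CompactSpace (absoluteGaloisGroup K) := absoluteGaloisGroup_compactSpace K
  haveI : CompactSpace (decomp (K := K) v) := isCompact_iff_compactSpace.mp (Coinv.isClosed_decomp v).isCompact
  have hAo : ∀ a : (W.geomPrimaryTorsion 3), IsOpen {g : decomp (K := K) v | g • a = a} := fun a ↦
    (Summit.BirchSwinnertonDyer.Rank1Residual.X11b.LocBridge.isOpen_stabilizer_geomPrimaryTorsion W 3 a).preimage continuous_subtype_val
  have hAt : IsPrimaryTorsion 3 (W.geomPrimaryTorsion 3) := isPrimaryTorsion_geomPrimaryTorsion W 3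
  have hAp : Set.Finite {a : (W.geomPrimaryTorsion 3) | 3 • a = 0} := by
    simpa only [pow_one] using finite_setOf_geomPrimaryTorsion_pow_smul_eq_zero W h3.ne_zero 1
  have hd₁' : (kappaD κ v d₁).toAdd = (3 : ℤ_[3]) ^ c := hd₁
  obtain ⟨t₄, ht₄⟩ := UniversalToricDescentLayerDescentKernelIndex.exists_forall_natCard_ker_resOfLe_le (kappaD κ v) hd₁' hAo hAt hAp
  refine ⟨(t₄ + 1) ^ (3 ^ c) * Nat.card (FixedPoints.addSubgroup (kerD κ v) (W.geomPrimaryTorsion 3) ⧸ D) ^ (3 ^ c), Nat.mul_pos (pow_pos (Nat.succ_pos _) _) (pow_pos ht₆pos _), fun k ↦ ?_⟩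
  -- `H¹(ker κ|_{D_v}, (W.geomPrimaryTorsion 3))[3^k]` is finite
  obtain ⟨sv, hsv⟩ := exists_natCard_pTorsion_subgroupH1_kerD_eq_pow W κ hv hvd
  haveI hTfin : Finite {f : subgroupH1 (kerD κ v) (W.geomPrimaryTorsion 3) // 3 ^ k • f = 0} :=
    Nat.finite_of_card_ne_zero (by
      rw [UniversalToricDescentLocalH1Divisible.natCard_pow_torsion_subgroupH1_kerD_eq_pow_mul W κ hv hvd hsv k]
      exact pow_ne_zero _ h3.ne_zero)
  haveI hTupfin : Finite {θ : Fin (3 ^ c) → subgroupH1 (kerD κ v) (W.geomPrimaryTorsion 3) // 3 ^ k • θ = 0} := by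
    refine Finite.of_injective (fun θ ↦ (fun i ↦ (⟨θ.1 i, ?_⟩ : {f : subgroupH1 (kerD κ v) (W.geomPrimaryTorsion 3) // 3 ^ k • f = 0}))) ?_
    · have h := congr_fun θ.2 i
      simpa using h
    · intro a b h
      apply Subtype.ext
      funext i
      have hi := congr_fun h i
      exact congrArg Subtype.val hi
  haveI hSigfin : Finite {θ : Fin (3 ^ c) → subgroupH1 (kerD κ v) (W.geomPrimaryTorsion 3) //
      3 ^ k • θ = 0 ∧ ∃ s : W.subgroupH1 3 κ.kerSubgroup, s ∈ selmerAc W 3 κ v₀ (insert v S) ∧ 3 ^ k • s = 0 ∧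
        ∀ i : Fin (3 ^ c), θ i = resKerD κ (W.geomPrimaryTorsion 3) v (W.conjH1 3 κ.kerSubgroup (γ ^ (i : ℕ)) s)} :=
    Finite.of_injective (fun θ ↦ (⟨θ.1, θ.2.1⟩ : {θ : Fin (3 ^ c) → subgroupH1 (kerD κ v) (W.geomPrimaryTorsion 3) // 3 ^ k • θ = 0}))
      fun a b h ↦ Subtype.ext (congrArg Subtype.val h :)
  rcases Nat.eq_zero_or_pos k with rfl | hk
  · -- `k = 0`: both sides count the zero tuple once
    have hL : Nat.card {θ : Fin (3 ^ c) → subgroupH1 (kerD κ v) (W.geomPrimaryTorsion 3) // 3 ^ 0 • θ = 0} = 1 := by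
      rw [Nat.card_eq_one_iff_unique]
      refine ⟨⟨fun a b ↦ Subtype.ext ?_⟩, ⟨⟨0, by simp⟩⟩⟩
      have ha := a.2; have hb := b.2
      simp only [pow_zero, one_smul] at ha hb
      rw [ha, hb]
    have hR : 1 ≤ Nat.card {θ : Fin (3 ^ c) → subgroupH1 (kerD κ v) (W.geomPrimaryTorsion 3) //
        3 ^ 0 • θ = 0 ∧ ∃ s : W.subgroupH1 3 κ.kerSubgroup, s ∈ selmerAc W 3 κ v₀ (insert v S) ∧ 3 ^ 0 • s = 0 ∧
          ∀ i : Fin (3 ^ c), θ i = resKerD κ (W.geomPrimaryTorsion 3) v (W.conjH1 3 κ.kerSubgroup (γ ^ (i : ℕ)) s)} := by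
      haveI : Nonempty {θ : Fin (3 ^ c) → subgroupH1 (kerD κ v) (W.geomPrimaryTorsion 3) //
          3 ^ 0 • θ = 0 ∧ ∃ s : W.subgroupH1 3 κ.kerSubgroup, s ∈ selmerAc W 3 κ v₀ (insert v S) ∧ 3 ^ 0 • s = 0 ∧
            ∀ i : Fin (3 ^ c), θ i = resKerD κ (W.geomPrimaryTorsion 3) v (W.conjH1 3 κ.kerSubgroup (γ ^ (i : ℕ)) s)} :=
        ⟨⟨0, by simp, 0, AddSubgroup.zero_mem _, by simp, fun i ↦ by simp⟩⟩
      exact Nat.card_pos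
    rw [hL]
    calc 1 ≤ (t₄ + 1) ^ (3 ^ c) * Nat.card (FixedPoints.addSubgroup (kerD κ v) (W.geomPrimaryTorsion 3) ⧸ D) ^ (3 ^ c) := Nat.mul_pos (pow_pos (Nat.succ_pos _) _) (pow_pos ht₆pos _)
      _ = (t₄ + 1) ^ (3 ^ c) * Nat.card (FixedPoints.addSubgroup (kerD κ v) (W.geomPrimaryTorsion 3) ⧸ D) ^ (3 ^ c) * 1 := (mul_one _).symm
      _ ≤ (t₄ + 1) ^ (3 ^ c) * Nat.card (FixedPoints.addSubgroup (kerD κ v) (W.geomPrimaryTorsion 3) ⧸ D) ^ (3 ^ c) * _ := Nat.mul_le_mul_left _ hR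
  -- `k ≥ 1`
  -- finiteness of `Sel^{S∪v}_{𝔭'}(K_∞, E[3^∞])[3^k]`
  have hfinF : Set.Finite {s : W.subgroupH1 3 κ.kerSubgroup | s ∈ selmerAc W 3 κ 𝔭' (insert v S) ∧ 3 ^ k • s = 0} := by
    have h1 := finite_pow_torsion (B := selmerAc W 3 κ 𝔭' (insert v S)) (p := 3) hfin k
    refine (h1.image Subtype.val).subset ?_
    rintro s ⟨hs, hsk⟩
    refine ⟨⟨s, hs⟩, ?_, rfl⟩
    simp only [Set.mem_setOf_eq]
    exact Subtype.ext (by simpa using hsk)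
  -- the three deep-layer inputs
  obtain ⟨m₁, hm₁⟩ := exists_forall_natCard_tuples_le_pairCount 3 κ v W hv d₁ hd₁ hdvd hR3 hKx hk
  obtain ⟨m₂, hm₂⟩ := exists_level_dualIndex_le W 3 k κ TK hB hγ h𝔭'T (insert v S) hfinF hv hvT hc hDmem hDdiv TL hTL VL hVL
  set m := max (max m₁ m₂) c with hmdef
  have hm₁m : m₁ ≤ m := (le_max_left _ _).trans (le_max_left _ _)
  have hm₂m : m₂ ≤ m := (le_max_right _ _).trans (le_max_left _ _)
  have hcm : c ≤ m := le_max_right _ _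
  -- the transport at layer `m`
  obtain ⟨ΦM, Φ, -, -, -, -, htors, -, hkum⟩ := exists_transportTorsion_primary W 3 k (κ.layer m)
    (layerSubgroup_le_galRange_layer 3 κ m) (mem_comapResGal_layer 3 κ m)
  have hPT := hPTfact (κ.layer m)
  have hTV : Disjoint (TL m) (VL m) :=
    disjoint_of_forall_mem_iff (S := (TK : Set (HeightOneSpectrum (𝓞 K)))) (fun h ↦ hvT ((hTKset v).mp h)) (hTL' m) (hVL m)
  -- (a)+(e)+R3
  have h1 := hm₁ m hm₁m hPT (TL m) (VL m) (hVL m) hTV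
  -- (d)
  have h2 := hm₂ m hm₂m
  -- (c)
  have hFIN : Finite {a : (W.geomPrimaryTorsion 3) // ∀ g : decomp (K := K) v, g ∈ decompIn (κ.layerSubgroup m) v → g • a = a} := by
    haveI := finite_layerFixed W 3 κ v m
    refine Finite.of_injective (fun a ↦ (⟨a.1, fun d hd ↦ a.2 d ?_⟩ : {a : (W.geomPrimaryTorsion 3) //
      ∀ d : decomp (K := K) v, (3 : ℤ_[3]) ^ m ∣ (κ (d : absoluteGaloisGroup K)).toAdd → (d : absoluteGaloisGroup K) • a = a})) ?_
    · rw [mem_decompIn_iff, ZpExtension.mem_layerSubgroup]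
      exact hd
    · intro a b h
      exact Subtype.ext (congrArg Subtype.val h :)
  have h3' := relIndex_kummerRelaxed_le W 3 k κ m TK v (κ.layer m) (TL m) (hTL m) (VL m) (hVL m) Φ hkum hvT hv hγ hcm hc hFIN ht₄
  -- the signature range injects into the realised signatures ((f): `…RelaxedKummerImage`)
  have hS' : ∀ u : HeightOneSpectrum (𝓞 K), ((3 : ℕ) : 𝓞 K) ∉ u.asIdeal → u ∉ insert v S → u ∉ TK ∧ u ≠ v := by
    intro u hu huS
    refine ⟨fun h ↦ ((hTK u).mp h).elim hu (fun h' ↦ huS (Set.mem_insert_of_mem _ h')), fun h ↦ huS (h ▸ Set.mem_insert _ _)⟩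
  -- assembly: pure arithmetic on the four bounds (no `set` abbreviations — they time out on the large Kummer terms)
  have key : ∀ {a b d r R B B' D' : ℕ}, a ≤ b * d → d ≤ D' → b ≤ r * B → r ≤ R → B ≤ B' → a ≤ B' * D' * R := by
    intro a b d r R B B' D' e1 e2 e3 e4 e5
    calc a ≤ b * d := e1
      _ ≤ (r * B) * D' := Nat.mul_le_mul e3 e2
      _ ≤ (R * B') * D' := Nat.mul_le_mul_right _ (Nat.mul_le_mul e4 e5)
      _ = B' * D' * R := by ring
  refine key h1 h2 h3' ?_ (Nat.pow_le_pow_left (Nat.le_succ _) _)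
  refine Nat.card_le_card_of_injective (fun x ↦ ⟨x.1, ?_⟩) (fun a b h ↦ Subtype.ext (congrArg Subtype.val h :))
  obtain ⟨y, hy⟩ := x.2
  obtain ⟨hmem, hsk⟩ := layerToInfty_mem_selmerAc_of_mem_kummerRelaxed_union W 3 k TK v (κ.layer m) (TL m) (hTL m) (VL m)
    (hVL m) κ m Φ htors hkum (insert v S) hS' v₀ hv₀ hv₀S y.2
  refine ⟨?_, W.layerToInfty κ m (Φ y), hmem, hsk, fun i ↦ ?_⟩
  · -- transport `3^k • h_m(Φ y) = 0` through `resKerD ∘ conj_{γ^i}` WITHOUT re-synthesising the scalar action on the source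
    -- (instance paths differ between modules and their defeq check times out): apply the maps to `hsk`, push with `map_nsmul`
    rw [← hy]
    funext i
    show 3 ^ k • resKerD κ (W.geomPrimaryTorsion 3) v
      (W.conjH1 3 κ.kerSubgroup (γ ^ (i : ℕ)) (W.layerToInfty κ m (Φ y))) = 0
    have h0 := congrArg (fun s ↦ resKerD κ (W.geomPrimaryTorsion 3) v (W.conjH1 3 κ.kerSubgroup (γ ^ (i : ℕ)) s)) hsk
    simp only [map_nsmul, map_zero] at h0
    exact h0
  · rw [← hy]
    rfl


end Summit.BirchSwinnertonDyer.BirchSwinnertonDyer.Cruxes.DefectTransportModThreePT.SigmaCongruence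

end
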